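import Summits.QuantumFields.YangMills.Theorems.IR.EsPolymerGasConditioning
import Summits.QuantumFields.YangMills.Theorems.IR.EsPolymerGasRatios

/-!
# Crux `IR` (item stmt-QuantumFields-19354) — line «es-polymer-decoupling», reshaped engine, input (c5a): THE LAWS OF ONE AND
OF TWO ANCHORED PARTS OF THE CELL GAS AS PARTITION-FUNCTION RATIOS

Helper module for item `stmt-QuantumFields-19354` (`--supports … --as helper`; it closes nothing; lead prover
ym-ir-line-mxc-p1 g2).  For activities `act` on the polymers of the cell torus (extended by `0`, `actC`), the anchored
sets `𝒜_c = {polymers with a cell within k+1 of c}` and the excluded sets `D_c(X) = {polymers near c or touching X}`: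

* `sum_prod_nearFamily_eq_ite` — `∑_{Γ compatible, nearFamily Γ c k = X} ∏_Γ act = [X ⊆ 𝒜_c compatible] · (∏_X act) ·
  Ξ(Λ ∖ D_c(X))` (the law of ONE near family; `Theorems/IR/EsPolymerGasConditioning.lean`);
* `sum_prod_nearFamily_pair_eq` — for `X ⊆ 𝒜_A`, `Y ⊆ 𝒜_B` with `X ∪ Y` compatible, no member of `X` near `B` and no
  member of `Y` near `A`: `∑_{Γ compatible, N_A Γ = X, N_B Γ = Y} ∏_Γ act = (∏_{X∪Y} act) · Ξ(Λ ∖ (D_A(X) ∪ D_B(Y)))`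
  (the JOINT law of two near families), ready for the two-region ratio identity of `Theorems/IR/EsPolymerGasRatios.lean`.

HONEST FRAMING: bookkeeping for an OPEN engine stub of a CONDITIONAL rung line; nothing about Yang–Mills is proved here. -/

set_option autoImplicit false

noncomputable section

open Finset
open Literature.Probability.LatticeModels (IsCompatible polymerPartitionFunction GeomInc Touches IsCompatible.mono
  polymerPartitionFunction_congr)

namespace Summit.QuantumFields.YangMills.Cruxes.IR.EsPolymer

variable {q : ℕ}

/-- The activities extended by `0` off the polymers, as complex numbers (the tree's `polymerPartitionFunction` vocabulary). -/
def actC (act : Finset (Cell q) → ℝ) (γ : Finset (Cell q)) : ℂ :=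
  by classical exact if IsPolymer γ then ((act γ : ℝ) : ℂ) else 0

/-- On polymers `actC act γ = act γ`. -/
theorem actC_of_isPolymer (act : Finset (Cell q) → ℝ) {γ : Finset (Cell q)} (h : IsPolymer γ) :
    actC act γ = ((act γ : ℝ) : ℂ) := by
  unfold actC; classical exact if_pos h

/-- Off polymers `actC act γ = 0`. -/
theorem actC_of_not_isPolymer (act : Finset (Cell q) → ℝ) {γ : Finset (Cell q)} (h : ¬ IsPolymer γ) :
    actC act γ = 0 := by
  unfold actC; classical exact if_neg h

/-- `‖actC act γ‖ ≤ p^{#γ}` when `0 ≤ act ≤ p^#`. -/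
theorem norm_actC_le (act : Finset (Cell q) → ℝ) (hact : ∀ γ, 0 ≤ act γ) {p : ℝ} (hp : 0 ≤ p)
    (hactp : ∀ γ, act γ ≤ p ^ γ.card) (γ : Finset (Cell q)) : ‖actC act γ‖ ≤ p ^ γ.card := by
  by_cases h : IsPolymer γ
  · rw [actC_of_isPolymer act h, Complex.norm_real, Real.norm_eq_abs, abs_of_nonneg (hact γ)]; exact hactp γ
  · rw [actC_of_not_isPolymer act h, norm_zero]; exact pow_nonneg hp _

/-- A partition function over a family of polymers may be computed with `actC`. -/
theorem polymerPartitionFunction_actC_eq (act : Finset (Cell q) → ℝ) {Λ' : Finset (Finset (Cell q))}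
    (hΛ' : ∀ γ ∈ Λ', IsPolymer γ) :
    polymerPartitionFunction (GeomInc fun x y : Cell q => cellDist x y ≤ 6) (actC act) Λ' =
      polymerPartitionFunction (GeomInc fun x y : Cell q => cellDist x y ≤ 6) (fun γ => ((act γ : ℝ) : ℂ)) Λ' :=
  polymerPartitionFunction_congr fun γ hγ => actC_of_isPolymer act (hΛ' γ hγ)

open Classical in
/-- **The law of ONE near family**: `∑_{Γ compatible, nearFamily Γ c k = X} ∏_Γ act =
[X compatible ∧ X ⊆ 𝒜_c] · (∏_X act) · Ξ_{actC}(Λ ∖ D_c(X))`. -/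
theorem sum_prod_nearFamily_eq_ite (act : Finset (Cell q) → ℝ) (c : Cell q) (k : ℕ) (X : Finset (Finset (Cell q))) :
    ((∑ Γ ∈ Finset.univ.filter (fun Γ : Finset (Finset (Cell q)) => Compatible Γ ∧ nearFamily Γ c k = X),
        ∏ γ ∈ Γ, act γ : ℝ) : ℂ) =
      if IsCompatible (GeomInc fun x y : Cell q => cellDist x y ≤ 6) X ∧
          X ⊆ (Finset.univ.filter fun γ : Finset (Cell q) => IsPolymer γ).filter fun γ => ∃ c' ∈ γ, cellDist c c' ≤ k + 1
      then (∏ x ∈ X, ((act x : ℝ) : ℂ)) *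
        polymerPartitionFunction (GeomInc fun x y : Cell q => cellDist x y ≤ 6) (actC act)
          ((Finset.univ.filter fun γ : Finset (Cell q) => IsPolymer γ) \
            ((Finset.univ.filter fun γ : Finset (Cell q) => IsPolymer γ).filter fun γ =>
              (∃ c' ∈ γ, cellDist c c' ≤ k + 1) ∨ ∃ x ∈ X, GeomInc (fun x y : Cell q => cellDist x y ≤ 6) x γ))
      else 0 := by
  rw [sum_prod_filter_nearFamily_eq act c k X]
  split_ifs with h
  · obtain ⟨hXc, hX𝒜⟩ := h
    rw [sum_prod_filter_inter_eq (fun a b h => geomInc_cellDist_symm a b h) (fun γ => ((act γ : ℝ) : ℂ))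
      (filter_subset _ _) hX𝒜 hXc,
      polymerPartitionFunction_actC_eq act fun γ hγ => (mem_filter.1 (mem_sdiff.1 hγ).1).2]
    congr 2
    ext γ
    simp only [mem_filter, mem_sdiff, mem_univ, true_and, not_or, not_and_or]
    constructor
    · rintro ⟨hP, hn, hni⟩
      refine ⟨hP, Or.inr ⟨?_, fun h => ?_⟩⟩
      · rcases hn with hn | hn
        · exact absurd hP hn
        · exact hn
      · obtain ⟨x, hx, hinc⟩ := h
        exact hni x hx hinc
    · rintro ⟨hP, h⟩
      rcases h with h | ⟨hnear, hni⟩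
      · exact absurd hP h
      · exact ⟨hP, Or.inr hnear, fun x hx hinc => hni ⟨x, hx, hinc⟩⟩
  · exact sum_prod_filter_inter_eq_zero _ h

open Classical in
/-- **The JOINT law of two near families** (short, mutually far parts): for `X ⊆ 𝒜_A`, `Y ⊆ 𝒜_B`, `X ∪ Y` compatible, no
member of `Y` near `A` and no member of `X` near `B`,
`∑_{Γ compatible, N_A Γ = X, N_B Γ = Y} ∏_Γ act = (∏_{X ∪ Y} act) · Ξ_{actC}(Λ ∖ (D_A(X) ∪ D_B(Y)))`. -/
theorem sum_prod_nearFamily_pair_eq (act : Finset (Cell q) → ℝ) (cA cB : Cell q) (k : ℕ)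
    {X Y : Finset (Finset (Cell q))}
    (hX : X ⊆ (Finset.univ.filter fun γ : Finset (Cell q) => IsPolymer γ).filter fun γ => ∃ c' ∈ γ, cellDist cA c' ≤ k + 1)
    (hY : Y ⊆ (Finset.univ.filter fun γ : Finset (Cell q) => IsPolymer γ).filter fun γ => ∃ c' ∈ γ, cellDist cB c' ≤ k + 1)
    (hXY : IsCompatible (GeomInc fun x y : Cell q => cellDist x y ≤ 6) (X ∪ Y))
    (hXB : ∀ x ∈ X, ¬ ∃ c' ∈ x, cellDist cB c' ≤ k + 1) (hYA : ∀ y ∈ Y, ¬ ∃ c' ∈ y, cellDist cA c' ≤ k + 1) :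
    ((∑ Γ ∈ Finset.univ.filter (fun Γ : Finset (Finset (Cell q)) =>
        Compatible Γ ∧ nearFamily Γ cA k = X ∧ nearFamily Γ cB k = Y), ∏ γ ∈ Γ, act γ : ℝ) : ℂ) =
      (∏ x ∈ X ∪ Y, ((act x : ℝ) : ℂ)) *
        polymerPartitionFunction (GeomInc fun x y : Cell q => cellDist x y ≤ 6) (actC act)
          ((Finset.univ.filter fun γ : Finset (Cell q) => IsPolymer γ) \
            (((Finset.univ.filter fun γ : Finset (Cell q) => IsPolymer γ).filter fun γ =>
                (∃ c' ∈ γ, cellDist cA c' ≤ k + 1) ∨ ∃ x ∈ X, GeomInc (fun x y : Cell q => cellDist x y ≤ 6) x γ) ∪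
              ((Finset.univ.filter fun γ : Finset (Cell q) => IsPolymer γ).filter fun γ =>
                (∃ c' ∈ γ, cellDist cB c' ≤ k + 1) ∨ ∃ y ∈ Y, GeomInc (fun x y : Cell q => cellDist x y ≤ 6) y γ))) := by
  set Λ : Finset (Finset (Cell q)) := Finset.univ.filter fun γ : Finset (Cell q) => IsPolymer γ with hΛ
  set 𝒜 : Finset (Finset (Cell q)) := Λ.filter fun γ => ∃ c' ∈ γ, cellDist cA c' ≤ k + 1 with h𝒜
  set ℬ : Finset (Finset (Cell q)) := Λ.filter fun γ => ∃ c' ∈ γ, cellDist cB c' ≤ k + 1 with hℬ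
  -- two-anchor bridge: the fibre is `{Γ ⊆ Λ compatible, Γ ∩ (𝒜 ∪ ℬ) = X ∪ Y}`
  have hbridge : ((∑ Γ ∈ Finset.univ.filter (fun Γ : Finset (Finset (Cell q)) =>
      Compatible Γ ∧ nearFamily Γ cA k = X ∧ nearFamily Γ cB k = Y), ∏ γ ∈ Γ, act γ : ℝ) : ℂ) =
      ∑ Γ ∈ Λ.powerset with (IsCompatible (GeomInc fun x y : Cell q => cellDist x y ≤ 6) Γ ∧ Γ ∩ (𝒜 ∪ ℬ) = X ∪ Y),
        ∏ γ ∈ Γ, ((act γ : ℝ) : ℂ) := by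
    push_cast
    refine sum_congr ?_ fun Γ _ => rfl
    ext Γ
    simp only [mem_filter, mem_univ, true_and, mem_powerset]
    constructor
    · rintro ⟨hΓ, hXe, hYe⟩
      obtain ⟨hpoly, hcomp⟩ := (compatible_iff Γ).1 hΓ
      refine ⟨fun γ hγ => mem_filter.2 ⟨mem_univ _, hpoly γ hγ⟩, hcomp, ?_⟩
      rw [← hXe, ← hYe, nearFamily_eq_inter, nearFamily_eq_inter]
      ext γ
      simp only [mem_inter, mem_union, mem_filter, mem_univ, true_and, h𝒜, hℬ, hΛ]
      constructor
      · rintro ⟨hγ, h | h⟩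
        · exact Or.inl ⟨hγ, h.2⟩
        · exact Or.inr ⟨hγ, h.2⟩
      · rintro (⟨hγ, h⟩ | ⟨hγ, h⟩)
        · exact ⟨hγ, Or.inl ⟨hpoly γ hγ, h⟩⟩
        · exact ⟨hγ, Or.inr ⟨hpoly γ hγ, h⟩⟩
    · rintro ⟨hsub, hcomp, hXY'⟩
      have hpoly : ∀ γ ∈ Γ, IsPolymer γ := fun γ hγ => (mem_filter.1 (hsub hγ)).2
      refine ⟨(compatible_iff Γ).2 ⟨hpoly, hcomp⟩, ?_, ?_⟩
      · rw [nearFamily_eq_inter]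
        ext γ
        simp only [mem_inter, mem_filter, mem_univ, true_and]
        constructor
        · rintro ⟨hγ, hnear⟩
          have hmem : γ ∈ Γ ∩ (𝒜 ∪ ℬ) := mem_inter.2 ⟨hγ, mem_union.2 (Or.inl (mem_filter.2
            ⟨mem_filter.2 ⟨mem_univ _, hpoly γ hγ⟩, hnear⟩))⟩
          rw [hXY'] at hmem
          rcases mem_union.1 hmem with h | h
          · exact h
          · exact absurd hnear (hYA γ h)
        · intro hx
          have hmem : γ ∈ X ∪ Y := mem_union.2 (Or.inl hx)
          rw [← hXY'] at hmem
          exact ⟨(mem_inter.1 hmem).1, (mem_filter.1 (hX hx)).2⟩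
      · rw [nearFamily_eq_inter]
        ext γ
        simp only [mem_inter, mem_filter, mem_univ, true_and]
        constructor
        · rintro ⟨hγ, hnear⟩
          have hmem : γ ∈ Γ ∩ (𝒜 ∪ ℬ) := mem_inter.2 ⟨hγ, mem_union.2 (Or.inr (mem_filter.2
            ⟨mem_filter.2 ⟨mem_univ _, hpoly γ hγ⟩, hnear⟩))⟩
          rw [hXY'] at hmem
          rcases mem_union.1 hmem with h | h
          · exact absurd hnear (hXB γ h)
          · exact h
        · intro hy
          have hmem : γ ∈ X ∪ Y := mem_union.2 (Or.inr hy)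
          rw [← hXY'] at hmem
          exact ⟨(mem_inter.1 hmem).1, (mem_filter.1 (hY hy)).2⟩
  rw [hbridge, sum_prod_filter_inter_eq (fun a b h => geomInc_cellDist_symm a b h) (fun γ => ((act γ : ℝ) : ℂ))
    (union_subset (filter_subset _ _) (filter_subset _ _)) (union_subset_union hX hY) hXY]
  rw [polymerPartitionFunction_actC_eq act fun γ hγ => (mem_filter.1 (mem_sdiff.1 hγ).1).2]
  congr 2
  ext γ
  simp only [mem_filter, mem_sdiff, mem_union, mem_univ, true_and, not_or, or_imp, forall_and, hΛ, not_and_or]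
  constructor
  · rintro ⟨hP, ⟨hnA, hnB⟩, hniX, hniY⟩
    refine ⟨hP, ⟨Or.inr ⟨?_, ?_⟩, Or.inr ⟨?_, ?_⟩⟩⟩
    · rcases hnA with h | h
      · exact absurd hP h
      · exact h
    · rintro ⟨x, hx, hinc⟩; exact hniX x hx hinc
    · rcases hnB with h | h
      · exact absurd hP h
      · exact h
    · rintro ⟨y, hy, hinc⟩; exact hniY y hy hinc
  · rintro ⟨hP, hA, hB⟩
    rcases hA with hA | ⟨hnA, hniX⟩
    · exact absurd hP hA
    rcases hB with hB | ⟨hnB, hniY⟩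
    · exact absurd hP hB
    exact ⟨hP, ⟨Or.inr hnA, Or.inr hnB⟩, fun x hx hinc => hniX ⟨x, hx, hinc⟩, fun y hy hinc => hniY ⟨y, hy, hinc⟩⟩

end Summit.QuantumFields.YangMills.Cruxes.IR.EsPolymer

end
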